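import Mathlib.Analysis.SpecialFunctions.Log.Base
import Literature.MathematicalPhysics.QuantumFieldTheory.Balaban1983to89.T4TermwiseClosure

/-!
# Spine/NE7/SpineRemainderRateLog — the POLYNOMIAL branch: a producer that delivers only `δ_K ≤ D·(K+1)^{−n}` (`n ≥ 2`)
# certifies convergence of the unit-scale generating functions at the rate `(K+1)^{1−n}` — LOGARITHMIC in the lattice
# spacing, `(1 + log_L(1∕a_K))^{1−n}` — and no better

Cell `pub-balaban-gaps` (YM blitz Y1, track G2, seat `ne7`, generation 13); text of record
`run/shared/lean/pub/pub-balaban-gaps/ne/NE7.md` (census R71 ∕ R74 dictionary).  46th `Spine/NE7/` file; 0 `def`, 0 sorry;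
[folklore] real analysis + [bookkeeping]; companion of file 45 `SpineRemainderRate` (the geometric × polynomial branch).

WHY.  File 45 names the rate the spine's node-level remainder `T4CauchySum.delta_le` predicts when EVERY producer delivers an
injected rate with ratio `< 1`: `(K+1)^{c+1}·max(θ,ρ)^K`, a power `a^{β′}` of the spacing up to logarithms.  But along the
term-wise route of record some producers are, AS TYPED TODAY, only POLYNOMIALLY summable in `K`
(`T4TermwiseClosure.delta_le_crossover`'s docstring: «the other kinds' `rO` and the H-U5b-1 deviations `s` … along the tree's
present producers only POLYNOMIALLY summable: `T4Crossover.summable_sum_min_coupling`, `T4MatchingClosure.summable_polyRate_of_kappa`»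
— exponent `κ₀∕2 − 1 ≥ 3` by `polyExponent_of_kappa`).  This file records what such a producer certifies and ONLY that:
§1 the telescoping tail `Σ_{i≥0} (J+1+i)^{−(m+2)} ≤ 1∕((m+1)·J^{m+1})` for `J ≥ 1` (from `(k+1)^{m+1} − k^{m+1} ≥ (m+1)k^m`),
§2 the rate face `δ_K ≤ D·(K+1)^{−(m+2)}` ⟹ `|genFun Z K t − genFunLim Z t| ≤ 2·vol·D·((m+2)∕(m+1))·(K+1)^{−(m+1)}`,
§3 the dictionary `K + 1 = 1 + log_L(1∕a_K)` (`a_K = (L^K)⁻¹`): a polynomial rate in the number of steps is a power of the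
LOGARITHM of the spacing — so a power-law-in-`a` statement for the MODEL observable of census R71 needs every producer in
geometric form (file 45's hypothesis), which for the marginal-coupling channel is node U2's injected rate with `θc < 1`
(as the b2b desk's docked END takes it: `InjectedRate Cd 0 θc (disc …)`), not the polynomial fallback.

HONEST FRAMING.  [folklore] real analysis over the HYPOTHESIS `MatchingModConstants`; NO estimate of Bałaban's is asserted; which
branch a producer lands in is that producer's business (rows NE2∕NE3∕NE5∕NE9, node U2), not decided here.  NE7 NOT proved and NOT
in print; spine 0∕9; one fixed finite T⁴ — NOT ℝ⁴, NOT infinite volume, NOT a mass gap, NOT Clay.  No word moves (R10).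
-/

noncomputable section

open Finset
open scoped BigOperators

namespace Summit.QuantumFields.BalabanUV.T4Continuum.Spine.NE7

open Literature.MathematicalPhysics.QuantumFieldTheory.Balaban1983to89
open Literature.MathematicalPhysics.QuantumFieldTheory.Balaban1983to89.T4CauchySum
open Literature.MathematicalPhysics.QuantumFieldTheory.Balaban1983to89.T4TermwiseClosure

/-! ## §1 The telescoping tail of `Σ (J+1+i)^{−n}` -/

/-- Bernoulli's step: `x^{m+1} + (m+1)·x^m ≤ (x+1)^{m+1}` for `x ≥ 0` (induction on `m`). [folklore] -/
theorem pow_succ_add_mul_pow_le (x : ℝ) (hx : 0 ≤ x) :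
    ∀ m : ℕ, x ^ (m + 1) + ((m : ℝ) + 1) * x ^ m ≤ (x + 1) ^ (m + 1)
  | 0 => by simp
  | m + 1 => by
      have ih := pow_succ_add_mul_pow_le x hx m
      have hxm : 0 ≤ x ^ m := pow_nonneg hx m
      have hx1 : 0 ≤ x + 1 := by linarith
      calc x ^ (m + 1 + 1) + (((m + 1 : ℕ) : ℝ) + 1) * x ^ (m + 1)
          = x * (x ^ (m + 1) + ((m : ℝ) + 1) * x ^ m) + x ^ (m + 1) := by push_cast; ring
        _ ≤ x * (x + 1) ^ (m + 1) + (x ^ (m + 1) + ((m : ℝ) + 1) * x ^ m) := by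
            nlinarith [mul_le_mul_of_nonneg_left ih hx, mul_nonneg (by positivity : (0 : ℝ) ≤ (m : ℝ) + 1) hxm]
        _ ≤ x * (x + 1) ^ (m + 1) + (x + 1) ^ (m + 1) := by linarith
        _ = (x + 1) ^ (m + 1 + 1) := by ring

/-- The telescoping step: for `x ≥ 1`, `((x+1)^{m+2})⁻¹ ≤ ((x^{m+1})⁻¹ − ((x+1)^{m+1})⁻¹)∕(m+1)`. [folklore] -/
theorem inv_pow_le_telescope {x : ℝ} (hx : 1 ≤ x) (m : ℕ) :
    ((x + 1) ^ (m + 2))⁻¹ ≤ ((x ^ (m + 1))⁻¹ - ((x + 1) ^ (m + 1))⁻¹) / ((m : ℝ) + 1) := by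
  have hx0 : 0 < x := by linarith
  have hx1 : 0 < x + 1 := by linarith
  have hA : 0 < x ^ (m + 1) := pow_pos hx0 _
  have hB : 0 < (x + 1) ^ (m + 1) := pow_pos hx1 _
  have hB2 : 0 < (x + 1) ^ (m + 2) := pow_pos hx1 _
  have hm : (0 : ℝ) < (m : ℝ) + 1 := by positivity
  have key : ((m : ℝ) + 1) * x ^ m ≤ (x + 1) ^ (m + 1) - x ^ (m + 1) := by
    have := pow_succ_add_mul_pow_le x hx0.le m
    linarith
  rw [inv_sub_inv hA.ne' hB.ne', le_div_iff₀ hm, div_eq_mul_inv]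
  have hxx : x ^ (m + 1) * (x + 1) ^ (m + 1) ≤ x ^ m * (x + 1) ^ (m + 2) := by
    have e : x ^ m * (x + 1) ^ (m + 2) = (x ^ m * (x + 1)) * (x + 1) ^ (m + 1) := by ring
    rw [e, pow_succ]
    exact mul_le_mul_of_nonneg_right (mul_le_mul_of_nonneg_left (by linarith) (pow_nonneg hx0.le m)) hB.le
  have h1 : ((m : ℝ) + 1) / (x + 1) ^ (m + 2) ≤ (((m : ℝ) + 1) * x ^ m) / (x ^ (m + 1) * (x + 1) ^ (m + 1)) := by
    rw [div_le_div_iff₀ hB2 (mul_pos hA hB)]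
    calc ((m : ℝ) + 1) * (x ^ (m + 1) * (x + 1) ^ (m + 1))
        ≤ ((m : ℝ) + 1) * (x ^ m * (x + 1) ^ (m + 2)) := mul_le_mul_of_nonneg_left hxx hm.le
      _ = (((m : ℝ) + 1) * x ^ m) * (x + 1) ^ (m + 2) := by ring
  have e1 : ((x + 1) ^ (m + 2))⁻¹ * ((m : ℝ) + 1) = ((m : ℝ) + 1) / (x + 1) ^ (m + 2) := by
    rw [div_eq_mul_inv, mul_comm]
  have e2 : ((x + 1) ^ (m + 1) - x ^ (m + 1)) * (x ^ (m + 1) * (x + 1) ^ (m + 1))⁻¹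
      = ((x + 1) ^ (m + 1) - x ^ (m + 1)) / (x ^ (m + 1) * (x + 1) ^ (m + 1)) := by rw [div_eq_mul_inv]
  rw [e1, e2]
  exact h1.trans (div_le_div_of_nonneg_right key (mul_pos hA hB).le)

/-- Partial sums telescope: for `J ≥ 1`, `Σ_{i<M} ((J+1+i)^{m+2})⁻¹ ≤ ((J^{m+1})⁻¹ − ((J+M)^{m+1})⁻¹)∕(m+1)`. [folklore] -/
theorem sum_range_inv_pow_le {J : ℝ} (hJ : 1 ≤ J) (m : ℕ) :
    ∀ M : ℕ, ∑ i ∈ range M, ((J + 1 + (i : ℝ)) ^ (m + 2))⁻¹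
      ≤ ((J ^ (m + 1))⁻¹ - ((J + (M : ℝ)) ^ (m + 1))⁻¹) / ((m : ℝ) + 1)
  | 0 => by simp
  | M + 1 => by
      have ih := sum_range_inv_pow_le hJ m M
      have hstep := inv_pow_le_telescope (x := J + (M : ℝ)) (by have := (Nat.cast_nonneg M : (0:ℝ) ≤ M); linarith) m
      rw [sum_range_succ]
      have e1 : J + 1 + (M : ℝ) = J + (M : ℝ) + 1 := by ring
      have e2 : J + ((M + 1 : ℕ) : ℝ) = J + (M : ℝ) + 1 := by push_cast; ring
      rw [e1, e2]
      have : ((J ^ (m + 1))⁻¹ - ((J + (M : ℝ)) ^ (m + 1))⁻¹) / ((m : ℝ) + 1)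
          + (((J + (M : ℝ)) ^ (m + 1))⁻¹ - ((J + (M : ℝ) + 1) ^ (m + 1))⁻¹) / ((m : ℝ) + 1)
          = ((J ^ (m + 1))⁻¹ - ((J + (M : ℝ) + 1) ^ (m + 1))⁻¹) / ((m : ℝ) + 1) := by ring
      linarith

/-- **TAIL BOUND**: for `J ≥ 1`, the series `Σ_{i≥0} ((J+1+i)^{m+2})⁻¹` converges and is `≤ 1∕((m+1)·J^{m+1})`. [folklore] -/
theorem tsum_inv_pow_tail_le {J : ℝ} (hJ : 1 ≤ J) (m : ℕ) :
    Summable (fun i : ℕ => ((J + 1 + (i : ℝ)) ^ (m + 2))⁻¹) ∧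
      ∑' i : ℕ, ((J + 1 + (i : ℝ)) ^ (m + 2))⁻¹ ≤ (J ^ (m + 1))⁻¹ / ((m : ℝ) + 1) := by
  have h0 : ∀ i : ℕ, 0 ≤ ((J + 1 + (i : ℝ)) ^ (m + 2))⁻¹ := fun i => by positivity
  have hbd : ∀ M : ℕ, ∑ i ∈ range M, ((J + 1 + (i : ℝ)) ^ (m + 2))⁻¹ ≤ (J ^ (m + 1))⁻¹ / ((m : ℝ) + 1) := by
    intro M
    refine (sum_range_inv_pow_le hJ m M).trans ?_
    have hpos : 0 ≤ ((J + (M : ℝ)) ^ (m + 1))⁻¹ := by positivity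
    have hm : (0 : ℝ) < (m : ℝ) + 1 := by positivity
    exact div_le_div_of_nonneg_right (by linarith) hm.le
  exact ⟨summable_of_sum_range_le h0 hbd, Real.tsum_le_of_sum_range_le h0 hbd⟩

/-! ## §2 The rate face for a polynomial producer -/

/-- **`(K+1)^{−n}` TAIL** (`n = m+2 ≥ 2`): if the remainders of `MatchingModConstants vol l₀ δ Z` obey `δ K ≤ D·((K+1)^{m+2})⁻¹`
with `0 ≤ D`, then `|genFun Z K t − genFunLim Z t| ≤ 2·vol·D·((m+2)∕(m+1))·((K+1)^{m+1})⁻¹` on `|t| ≤ l₀` — the generating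
functions approach their limit at the POLYNOMIAL rate `(K+1)^{−(m+1)}` (`T4TermwiseClosure.abs_genFun_sub_lim_le_of_le` + §1:
the tail splits as the `K`-th term `≤ D·(K+1)^{−(m+2)} ≤ D·(K+1)^{−(m+1)}` plus `Σ_{i≥0} D·(K+2+i)^{−(m+2)} ≤ D·(K+1)^{−(m+1)}∕(m+1)`).
[folklore] -/
theorem abs_genFun_sub_lim_le_of_inv_pow {vol l₀ D : ℝ} {m : ℕ} {δ : ℕ → ℝ} {Z : ℕ → ℝ → ℝ}
    (h : MatchingModConstants vol l₀ δ Z) (hvol : 0 < vol) (hl₀ : 0 ≤ l₀) (hD : 0 ≤ D)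
    (hle : ∀ K, δ K ≤ D * ((((K : ℕ) : ℝ) + 1) ^ (m + 2))⁻¹) {t : ℝ} (ht : |t| ≤ l₀) (K : ℕ) :
    |genFun Z K t - genFunLim Z t|
      ≤ 2 * vol * (D * (((m : ℝ) + 2) / ((m : ℝ) + 1)) * ((((K : ℕ) : ℝ) + 1) ^ (m + 1))⁻¹) := by
  set d : ℕ → ℝ := fun K => D * ((((K : ℕ) : ℝ) + 1) ^ (m + 2))⁻¹ with hd_def
  have hJ : (1 : ℝ) ≤ ((K : ℕ) : ℝ) + 1 := by have := (Nat.cast_nonneg K : (0:ℝ) ≤ K); linarith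
  obtain ⟨hsumT, htail⟩ := tsum_inv_pow_tail_le hJ m
  -- summability of `d` from the `J = 1` tail (index shift by one) is not needed in closed form: compare with the shifted tail
  have hd0 : ∀ K, 0 ≤ d K := fun K => by positivity
  have hdsum : Summable d := by
    -- `d (i+1) = D * ((1+1+i)^(m+2))⁻¹`, summable by the `J = 1` tail; then `summable_nat_add_iff`
    obtain ⟨hs1, -⟩ := tsum_inv_pow_tail_le (le_refl (1 : ℝ)) m
    have : Summable (fun i : ℕ => d (i + 1)) := by
      refine (hs1.mul_left D).congr fun i => ?_
      simp only [hd_def]; push_cast; ring_nf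
    exact (summable_nat_add_iff 1).mp this
  refine (abs_genFun_sub_lim_le_of_le h hvol hl₀ hle hdsum ht K).trans ?_
  -- split the tail: m = 0 term + shifted tail
  have hsK : Summable (fun i : ℕ => d (K + i)) := hdsum.comp_injective (add_right_injective K)
  rw [hsK.tsum_eq_zero_add]
  have hshift : ∑' i : ℕ, d (K + (i + 1)) = D * ∑' i : ℕ, (((((K : ℕ) : ℝ) + 1) + 1 + (i : ℝ)) ^ (m + 2))⁻¹ := by
    rw [← tsum_mul_left]
    refine tsum_congr fun i => ?_
    simp only [hd_def]; push_cast; ring_nf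
  rw [hshift]
  have hm : (0 : ℝ) < (m : ℝ) + 1 := by positivity
  have hK1 : (0 : ℝ) < ((K : ℕ) : ℝ) + 1 := by positivity
  have hP : 0 < (((K : ℕ) : ℝ) + 1) ^ (m + 1) := pow_pos hK1 _
  -- first piece: d K ≤ D ((K+1)^(m+1))⁻¹
  have h1 : d (K + 0) ≤ D * ((((K : ℕ) : ℝ) + 1) ^ (m + 1))⁻¹ := by
    simp only [hd_def, add_zero]
    refine mul_le_mul_of_nonneg_left ?_ hD
    refine inv_anti₀ hP ?_
    rw [pow_succ]
    exact le_mul_of_one_le_right hP.le hJ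
  -- second piece: the shifted tail
  have h2 : D * ∑' i : ℕ, (((((K : ℕ) : ℝ) + 1) + 1 + (i : ℝ)) ^ (m + 2))⁻¹
      ≤ D * (((((K : ℕ) : ℝ) + 1) ^ (m + 1))⁻¹ / ((m : ℝ) + 1)) := mul_le_mul_of_nonneg_left htail hD
  have hsum2 : d (K + 0) + D * ∑' i : ℕ, (((((K : ℕ) : ℝ) + 1) + 1 + (i : ℝ)) ^ (m + 2))⁻¹
      ≤ D * (((m : ℝ) + 2) / ((m : ℝ) + 1)) * ((((K : ℕ) : ℝ) + 1) ^ (m + 1))⁻¹ := by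
    have e : D * (((m : ℝ) + 2) / ((m : ℝ) + 1)) * ((((K : ℕ) : ℝ) + 1) ^ (m + 1))⁻¹
        = D * ((((K : ℕ) : ℝ) + 1) ^ (m + 1))⁻¹ + D * (((((K : ℕ) : ℝ) + 1) ^ (m + 1))⁻¹ / ((m : ℝ) + 1)) := by
      field_simp
      ring
    rw [e]
    exact add_le_add h1 h2
  exact mul_le_mul_of_nonneg_left hsum2 (by positivity)

/-- The tree's producers state polynomial rates with a REAL exponent (`T4MatchingClosure.summable_polyRate_of_kappa`:
`d K ≤ D·(K+1)^{−(κ₀∕2 − 1)}`); for `m + 2 ≤ p` such a bound implies the natural-exponent one used above: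
`(K+1)^{−p} ≤ ((K+1)^{m+2})⁻¹` (since `K + 1 ≥ 1`). [folklore] -/
theorem rpow_neg_le_inv_pow {x p : ℝ} (hx : 1 ≤ x) {n : ℕ} (hn : (n : ℝ) ≤ p) : x ^ (-p) ≤ (x ^ n)⁻¹ := by
  have hx0 : 0 < x := by linarith
  rw [Real.rpow_neg hx0.le, ← Real.rpow_natCast]
  exact inv_anti₀ (Real.rpow_pos_of_pos hx0 _) (Real.rpow_le_rpow_of_exponent_le hx hn)

/-- **REAL-EXPONENT FORM**: `δ K ≤ D·(K+1)^{−p}` with `m + 2 ≤ p`, `0 ≤ D` ⟹ the conclusion of `abs_genFun_sub_lim_le_of_inv_pow`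
(rate `(K+1)^{−(m+1)}`) — so `summable_polyRate_of_kappa`-type producers (exponent `κ₀∕2 − 1 ≥ 3`) plug in with `m + 2 = ⌊κ₀∕2 − 1⌋`.
[folklore] -/
theorem abs_genFun_sub_lim_le_of_rpow_neg {vol l₀ D p : ℝ} {m : ℕ} {δ : ℕ → ℝ} {Z : ℕ → ℝ → ℝ}
    (h : MatchingModConstants vol l₀ δ Z) (hvol : 0 < vol) (hl₀ : 0 ≤ l₀) (hD : 0 ≤ D) (hp : ((m : ℝ) + 2) ≤ p)
    (hle : ∀ K, δ K ≤ D * (((K : ℕ) : ℝ) + 1) ^ (-p)) {t : ℝ} (ht : |t| ≤ l₀) (K : ℕ) :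
    |genFun Z K t - genFunLim Z t|
      ≤ 2 * vol * (D * (((m : ℝ) + 2) / ((m : ℝ) + 1)) * ((((K : ℕ) : ℝ) + 1) ^ (m + 1))⁻¹) := by
  refine abs_genFun_sub_lim_le_of_inv_pow h hvol hl₀ hD (fun K => (hle K).trans ?_) ht K
  refine mul_le_mul_of_nonneg_left (rpow_neg_le_inv_pow ?_ ?_) hD
  · have := (Nat.cast_nonneg K : (0:ℝ) ≤ K); linarith
  · push_cast; linarith

/-! ## §3 Dictionary: polynomial in the number of steps = a power of the LOGARITHM of the spacing -/

/-- `K + 1 = 1 + log_L(1∕a_K)` with `a_K = (L^K)⁻¹`: the number of steps is the base-`L` logarithm of the inverse spacing, so the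
rate `(K+1)^{−(m+1)}` of §2 reads `(1 + log_L(1∕a))^{−(m+1)}` — LOGARITHMIC in the lattice spacing (compare file 45's
`pow_eq_spacing_rpow`: a geometric factor is a POWER of the spacing). [folklore] -/
theorem succ_eq_one_add_logb_inv_spacing {L : ℝ} (hL : 1 < L) (K : ℕ) :
    (K : ℝ) + 1 = 1 + Real.logb L ((L ^ K)⁻¹)⁻¹ := by
  rw [inv_inv, ← Real.rpow_natCast, Real.logb_rpow (zero_lt_one.trans hL) hL.ne']
  ring

end Summit.QuantumFields.BalabanUV.T4Continuum.Spine.NE7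

end
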